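import Mathlib
import Summits.QuantumFields.YangMills.Theses.GuardedThresholdRemoval
import Literature.MathematicalPhysics.QuantumFieldTheory.Balaban1983to89.T3ThresholdRemoval
import Literature.MathematicalPhysics.QuantumFieldTheory.Balaban1983to89.T3OrbitAverage
import Literature.MathematicalPhysics.QuantumFieldTheory.Balaban1983to89.BlockAveragingFederbush

/-!
# The PRINTED block averaging is continuous OFF the guard spheres; the original strings after one more averaging step
# (`coarseObs F 1 ℰp`) are continuous off the guard collars — `CoarseObsContinuousOffGuard` (route GuardedThresholdRemoval,
# support r302, stmt-QuantumFields-28154) BY NAME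

Companion to `…GuardedThresholdRemovalGuardedTransfer` (which closes the crux `GuardedTransfer`, stmt-QuantumFields-28026, through a
continuous collar-modified small-loop average).  This file records the DIRECT continuity facts about Bałaban's printed, guarded operation
`ℰp = expMeanLogSU` itself, which that route's split child `CoarseObsContinuousOffGuard` states:

§3  `corr expMeanLogSU U c = expMeanLogSU.avg (loopHol U c)` for EVERY configuration (the guarded `ESU` carries the same guard as `corr`);
    at a configuration none of whose (0.4) loop variables at `c` lies ON the guard sphere `dist₁ = δ_N` the small-loop average of the loop
    family is `ContinuousAt` (inside the open guard it is the analytic `exp[mean log]`, tree `ExpMeanLog.continuousOn_coe_ESU`; near a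
    configuration with a loop variable strictly outside, it is locally the constant `1`); hence the TOTAL block averaging
    `avgFun expMeanLogSU : SU(N)^{bonds of T^{(j)}} → SU(N)^{bonds of T^{(j+1)}}` is `ContinuousAt` every such configuration
    (`continuousAt_avgFun_expMeanLogSU`, any `SU(N)`, any lattice, any level).
§4  On the d = 3 towers: `coarseObs F 1 ℰp Cs u = ∏_{C∈Cs} W_C(avgFun ℰp u)` read through `fieldShift` (tree `avgFun_fieldShift`), so
    `coarseObs F 1 ℰp Cs` is `ContinuousAt` every refined unit configuration off the guard spheres (`continuousAt_coarseObs_one`) —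
    `CoarseObsContinuousOffGuard` by name (`coarseObsContinuousOffGuard_proof`); the complement of the open `η`-collar is closed and gauge
    invariant (`isClosed_offCollar`, `gaugeAct_mem_offCollar`), the form the thin-set transfer `…ThinSetTransfer` consumes.

HONEST FRAMING.  Continuity bookkeeping only (rung R3 RECORD line; no summit statement, no instance of `ContinuumYM3Torus`, nothing about
the YM mass gap).  Sources: [Balaban1987RG1] (0.4)–(0.7) p. 253, [Balaban1985Averaging] (8)/(11) pp. 18–19.
-/

noncomputable section

namespace Summit.QuantumFields.YangMills.Theorems.GuardedTransferOffGuard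

open MeasureTheory Filter Topology
open Literature.MathematicalPhysics.QuantumFieldTheory.Balaban1983to89
open Literature.MathematicalPhysics.QuantumFieldTheory.Balaban1983to89.T3ContinuumYM3Torus
open Literature.MathematicalPhysics.QuantumFieldTheory.Balaban1983to89.T3LevelShift
open Literature.MathematicalPhysics.QuantumFieldTheory.Balaban1983to89.Missing
open Literature.MathematicalPhysics.QuantumFieldTheory.Balaban1983to89.T4Continuum
open Literature.MathematicalPhysics.QuantumFieldTheory.Balaban1983to89.T3ThresholdRemoval
open Literature.MathematicalPhysics.QuantumFieldTheory.Balaban1983to89.T3OrbitAverage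
open Literature.MathematicalPhysics.QuantumFieldTheory.Balaban1983to89.T3UnitLawDensityEML (ℰp measurableE_ℰp)

/-! ## §0 Local helper -/

/-- Products of a list of functions continuous AT a point are continuous at that point (local helper). [folklore] -/
private theorem continuousAt_list_prod {X : Type*} [TopologicalSpace X] {ι : Type*} (f : ι → X → ℝ) {x : X}
    (hf : ∀ i, ContinuousAt (f i) x) : ∀ l : List ι, ContinuousAt (fun x => (l.map fun i => f i x).prod) x
  | [] => by simpa using continuousAt_const
  | i :: l => by
    show ContinuousAt (fun x => f i x * (l.map fun i => f i x).prod) x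
    exact (hf i).mul (continuousAt_list_prod f hf l)


/-! ## §3 The total (0.4) block averaging with the guarded printed operation is continuous OFF the guard spheres -/

section OffGuard

open BlockAveraging ExpMeanLog AveragingRT
open scoped Matrix.Norms.L2Operator

variable {P : Params} {j : ℕ} {n : Type} [Fintype n] [DecidableEq n] [Nonempty n]

/-- The radius of `expMeanLogSU` is `δ_N` (definitional unfolding). [folklore] -/
theorem expMeanLogSU_δ_eq : (expMeanLogSU (n := n)).δ = deltaSU n := rfl

/-- With the guarded printed operation `expMeanLogSU` the correction factor of (0.4) is `E` of the loop family for EVERY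
configuration (off the small-field domain both sides are `1`: `ESU` carries the same guard). [cite: Balaban1987RG1, (0.4) p.253] -/
theorem corr_expMeanLogSU_eq (U : GaugeField P j (Matrix.specialUnitaryGroup n ℂ)) (c : PBond P (j + 1)) :
    corr (expMeanLogSU (n := n)) U c = (expMeanLogSU (n := n)).avg (loopHol U c) := by
  unfold corr
  split_ifs with h
  · rfl
  · symm
    unfold LoopAverage.avg
    show ESU _ = 1
    exact ESU_of_not_small fun h' => h fun i => by
      have := h' (LoopAverage.enum (Idx P) i)
      rw [FederbushMean.dist1_SU_eq, expMeanLogSU_δ_eq]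
      simpa only [Function.comp_apply, Equiv.symm_apply_apply] using this

/-- `dist₁` is continuous on `SU(N)` (operator norm of `U − 1`; local helper, the tree has the `reTr` twin). [folklore] -/
private theorem continuous_dist1_SU : Continuous (dist1 : Matrix.specialUnitaryGroup n ℂ → ℝ) :=
  UnitaryModel.continuous_opDist1.comp (Literature.MathematicalPhysics.QuantumLattice.continuous_fundamentalRep n)

/-- **THE ONE CONTINUITY OBSERVATION.**  At a configuration none of whose (0.4) loop variables at the coarse bond `c` lies ON the
guard sphere `dist₁ = δ_N`, the small-loop average `E` of the loop family is continuous in the configuration: inside the open guard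
it is the analytic `exp[mean log]` (`continuousOn_coe_ESU`), and near a configuration with some loop variable strictly outside the
guard it is locally the constant `1`. [cite: Balaban1987RG1, (0.4) p.253] -/
theorem continuousAt_avg_loopHol (U₀ : GaugeField P j (Matrix.specialUnitaryGroup n ℂ)) (c : PBond P (j + 1))
    (h : ∀ i : Idx P, dist1 (loopHol U₀ c i) ≠ (expMeanLogSU (n := n)).δ) :
    ContinuousAt (fun U : GaugeField P j (Matrix.specialUnitaryGroup n ℂ) => (expMeanLogSU (n := n)).avg (loopHol U c)) U₀ := by
  unfold LoopAverage.avg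
  -- the loop family, reindexed, as a continuous map of the configuration
  let Φ : GaugeField P j (Matrix.specialUnitaryGroup n ℂ) → (Fin (Fintype.card (Idx P) - 1 + 1) → Matrix.specialUnitaryGroup n ℂ) :=
    fun U k => loopHol U c ((LoopAverage.enum (Idx P)).symm k)
  have hΦ : Continuous Φ :=
    continuous_pi fun k => (continuous_apply ((LoopAverage.enum (Idx P)).symm k)).comp (continuous_loopHol c)
  show ContinuousAt (fun U => ESU (Φ U)) U₀
  by_cases hs : ∀ i : Idx P, dist1 (loopHol U₀ c i) < (expMeanLogSU (n := n)).δ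
  · -- inside the open guard: `ESU` is continuous there
    let S : Set (Fin (Fintype.card (Idx P) - 1 + 1) → Matrix.specialUnitaryGroup n ℂ) :=
      {W | ∀ k, ‖(W k : Matrix n n ℂ) - 1‖ < deltaSU n}
    have hS : IsOpen S := by
      have hco : ∀ k, Continuous fun W : Fin (Fintype.card (Idx P) - 1 + 1) → Matrix.specialUnitaryGroup n ℂ =>
          (W k : Matrix n n ℂ) - 1 := fun k => (continuous_subtype_val.comp (continuous_apply k)).sub continuous_const
      show IsOpen {W : Fin (Fintype.card (Idx P) - 1 + 1) → Matrix.specialUnitaryGroup n ℂ | ∀ k, ‖(W k : Matrix n n ℂ) - 1‖ < deltaSU n}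
      rw [Set.setOf_forall]
      exact isOpen_iInter_of_finite fun k => isOpen_lt (hco k).norm continuous_const
    have hmem : Φ U₀ ∈ S := fun k => by
      show ‖((Φ U₀ k : Matrix.specialUnitaryGroup n ℂ) : Matrix n n ℂ) - 1‖ < deltaSU n
      rw [← FederbushMean.dist1_SU_eq, ← expMeanLogSU_δ_eq]
      exact hs _
    have hESU : ContinuousAt (ESU : (Fin (Fintype.card (Idx P) - 1 + 1) → Matrix.specialUnitaryGroup n ℂ) →
        Matrix.specialUnitaryGroup n ℂ) (Φ U₀) := by
      rw [Topology.IsInducing.subtypeVal.continuousAt_iff]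
      exact (continuousOn_coe_ESU (n := n)).continuousAt (hS.mem_nhds hmem)
    exact ContinuousAt.comp hESU hΦ.continuousAt
  · -- some loop variable strictly outside the closed guard: locally `ESU = 1`
    push Not at hs
    obtain ⟨i, hi⟩ := hs
    have hgt : (expMeanLogSU (n := n)).δ < dist1 (loopHol U₀ c i) := lt_of_le_of_ne hi (h i).symm
    have hO : IsOpen {U : GaugeField P j (Matrix.specialUnitaryGroup n ℂ) | (expMeanLogSU (n := n)).δ < dist1 (loopHol U c i)} :=
      isOpen_lt continuous_const (continuous_dist1_SU.comp ((continuous_apply i).comp (continuous_loopHol c)))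
    have hev : (fun U => ESU (Φ U)) =ᶠ[𝓝 U₀] fun _ => (1 : Matrix.specialUnitaryGroup n ℂ) := by
      filter_upwards [hO.mem_nhds hgt] with U hU
      refine ESU_of_not_small fun hall => ?_
      have hk := hall ((LoopAverage.enum (Idx P)) i)
      have hk' : dist1 (loopHol U c i) < (expMeanLogSU (n := n)).δ := by
        rw [FederbushMean.dist1_SU_eq, expMeanLogSU_δ_eq]
        simpa [Φ, Equiv.symm_apply_apply] using hk
      exact lt_irrefl _ (hU.trans hk')
    exact (continuousAt_const.congr_of_eventuallyEq hev :)

/-- Hence the TOTAL (0.4) BLOCK AVERAGING `avgFun expMeanLogSU : SU(N)^{bonds of T^{(j)}} → SU(N)^{bonds of T^{(j+1)}}` is continuous at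
every configuration none of whose one-step loop variables lies on a guard sphere. [cite: Balaban1987RG1, (0.4) p.253] -/
theorem continuousAt_avgFun_expMeanLogSU (U₀ : GaugeField P j (Matrix.specialUnitaryGroup n ℂ))
    (h : ∀ (c : PBond P (j + 1)) (i : Idx P), dist1 (loopHol U₀ c i) ≠ (expMeanLogSU (n := n)).δ) :
    ContinuousAt (avgFun (expMeanLogSU (n := n)) :
      GaugeField P j (Matrix.specialUnitaryGroup n ℂ) → GaugeField P (j + 1) (Matrix.specialUnitaryGroup n ℂ)) U₀ := by
  refine continuousAt_pi.2 fun c => ?_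
  show ContinuousAt (fun U : GaugeField P j (Matrix.specialUnitaryGroup n ℂ) => corr (expMeanLogSU (n := n)) U c * axialAvg U c) U₀
  simp only [corr_expMeanLogSU_eq]
  exact (continuousAt_avg_loopHol U₀ c (h c)).mul ((continuous_apply c).comp continuous_axialAvg).continuousAt

end OffGuard

/-! ## §4 The original string at step `K + 1` is continuous off the guard collars of the refined unit field; the theorem -/

section Main

open BlockAveraging ExpMeanLog

variable (F : T3Family)

/-- Equal moduli: level `1` of `F.P 1` and level `1` of the refined family's `(F.refine 1).P 0` (both `2·L^{m}` sites per direction —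
the ORIGINAL unit torus). [cite: Balaban1985UV3, (1)-(3) p.256] -/
theorem sitesPerDir_refine_one : (F.PP F.m 1).sitesPerDir 1 = (F.PP (F.m + 1) 0).sitesPerDir 1 :=
  F.sitesPerDir_eq (by omega)

/-- **THE ORIGINAL LOOP VARIABLE AT STEP `K + 1` AS A FUNCTION OF THE ONE-STEP AVERAGED REFINED UNIT FIELD**: `W̄_C` read at
step `1` of `F` on a configuration shifted from the refined unit torus is `W_C(avg u)` with ONE (0.4) block averaging `avg = avgFun ℰp`
from the refined unit torus `2L^{m+1}` to the original one `2L^{m}` (tree `avgFun_fieldShift`: the averaging is one map on the two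
towers; `avg¹ = avgFun` definitionally). [cite: Balaban1987RG1, (0.11) p.253] -/
theorem avgObs_one_eq (C : ULoop3 F) (u : GaugeField ((F.refine 1).P 0) 0 (Matrix.specialUnitaryGroup (Fin 2) ℂ)) :
    F.avgObs ℰp 1 C (fieldShift (sitesPerDir_refine_unit F 1) u) =
      loopAt (fieldShift (sitesPerDir_refine_one F) (avgFun ℰp u)) (C.1.atLevel 1) := by
  rw [T3Family.avgObs, ← avgFun_fieldShift ℰp (sitesPerDir_refine_unit F 1) (sitesPerDir_refine_one F)]
  rfl

/-- The same for a string of labels: `coarseObs F 1 ℰp Cs u = ∏_{C ∈ Cs} W_C(avg u)`. [cite: Balaban1987RG1, (0.11) p.253] -/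
theorem coarseObs_one_eq (Cs : List (ULoop3 F)) (u : GaugeField ((F.refine 1).P 0) 0 (Matrix.specialUnitaryGroup (Fin 2) ℂ)) :
    coarseObs F 1 ℰp Cs u =
      (Cs.map fun C => loopAt (fieldShift (sitesPerDir_refine_one F) (avgFun ℰp u)) (C.1.atLevel 1)).prod := by
  unfold coarseObs
  exact congrArg List.prod (List.map_congr_left fun C _ => avgObs_one_eq F C u)

/-- `coarseObs F 1 ℰp Cs` is CONTINUOUS AT every refined unit configuration none of whose one-step (0.4) loop variables lies on a
guard sphere `dist₁ = δ` (§3 + continuity of `fieldShift` and of the loop variables `Re tr`). [cite: Balaban1987RG1, (0.4) p.253] -/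
theorem continuousAt_coarseObs_one (Cs : List (ULoop3 F))
    (u₀ : GaugeField ((F.refine 1).P 0) 0 (Matrix.specialUnitaryGroup (Fin 2) ℂ))
    (h : ∀ (c : PBond ((F.refine 1).P 0) 1) (i : Idx ((F.refine 1).P 0)), dist1 (loopHol u₀ c i) ≠ (ℰp).δ) :
    ContinuousAt (coarseObs F 1 ℰp Cs) u₀ := by
  have hA : ContinuousAt (avgFun ℰp : GaugeField ((F.refine 1).P 0) 0 (Matrix.specialUnitaryGroup (Fin 2) ℂ) →
      GaugeField ((F.refine 1).P 0) (0 + 1) (Matrix.specialUnitaryGroup (Fin 2) ℂ)) u₀ :=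
    continuousAt_avgFun_expMeanLogSU u₀ h
  have hfs : Continuous (fieldShift (G := Matrix.specialUnitaryGroup (Fin 2) ℂ) (sitesPerDir_refine_one F)) :=
    continuous_pi fun _ => continuous_apply _
  have hC : ∀ C : ULoop3 F, ContinuousAt (fun u : GaugeField ((F.refine 1).P 0) 0 (Matrix.specialUnitaryGroup (Fin 2) ℂ) =>
      loopAt (fieldShift (sitesPerDir_refine_one F) (avgFun ℰp u)) (C.1.atLevel 1)) u₀ :=
    fun C => ((continuous_loopAt (C.1.atLevel 1)).comp hfs).continuousAt.comp hA
  have heq : coarseObs F 1 ℰp Cs = fun u =>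
      (Cs.map fun C => loopAt (fieldShift (sitesPerDir_refine_one F) (avgFun ℰp u)) (C.1.atLevel 1)).prod :=
    funext (coarseObs_one_eq F Cs)
  rw [heq]
  exact continuousAt_list_prod (fun (C : ULoop3 F) (u : GaugeField ((F.refine 1).P 0) 0 (Matrix.specialUnitaryGroup (Fin 2) ℂ)) =>
    loopAt (fieldShift (sitesPerDir_refine_one F) (avgFun ℰp u)) (C.1.atLevel 1)) hC Cs

/-- **`CoarseObsContinuousOffGuard` (support r302 of the same route, stmt-QuantumFields-28154 — the planner's split of `GuardedTransfer`,
LINE g7-C) HOLDS**, by name: it is literally `continuousAt_coarseObs_one`. [cite: Balaban1987RG1, (0.4) p.253] -/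
theorem coarseObsContinuousOffGuard_proof :
    Summit.QuantumFields.YangMills.Theses.GuardedThresholdRemoval.CoarseObsContinuousOffGuard :=
  fun F Cs U h => continuousAt_coarseObs_one F Cs U h

/-- The complement of the open `η`-collar of the guard spheres — `{u | ∀ c i, η ≤ |dist₁(W_{c,i}(u)) − δ|}` — is CLOSED. [cite: Balaban1987RG1, (0.4) p.253] -/
theorem isClosed_offCollar (P : Params) (η : ℝ) :
    IsClosed {u : GaugeField P 0 (Matrix.specialUnitaryGroup (Fin 2) ℂ) |
      ∀ (c : PBond P 1) (i : Idx P), η ≤ |dist1 (loopHol u c i) - (ℰp).δ|} := by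
  simp only [Set.setOf_forall]
  exact isClosed_iInter fun c => isClosed_iInter fun i => isClosed_le continuous_const
    ((continuous_dist1_SU.comp ((continuous_apply i).comp (continuous_loopHol c))).sub continuous_const).abs

/-- … and GAUGE INVARIANT (the loop variables transform by conjugation, `dist₁` is a class function). [cite: Balaban1985Averaging, (8) p.18] -/
theorem gaugeAct_mem_offCollar (P : Params) (η : ℝ) (v : GaugeTransf P 0 (Matrix.specialUnitaryGroup (Fin 2) ℂ))
    (u : GaugeField P 0 (Matrix.specialUnitaryGroup (Fin 2) ℂ))
    (hu : u ∈ {u : GaugeField P 0 (Matrix.specialUnitaryGroup (Fin 2) ℂ) |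
      ∀ (c : PBond P 1) (i : Idx P), η ≤ |dist1 (loopHol u c i) - (ℰp).δ|}) :
    GaugeField.gaugeAct v u ∈ {u : GaugeField P 0 (Matrix.specialUnitaryGroup (Fin 2) ℂ) |
      ∀ (c : PBond P 1) (i : Idx P), η ≤ |dist1 (loopHol u c i) - (ℰp).δ|} := by
  intro c i
  simp only [loopHol_gaugeAct, GaugeGroup.dist1_conj]
  exact hu c i

end Main

end Summit.QuantumFields.YangMills.Theorems.GuardedTransferOffGuard

end
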